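import Literature.Analysis.FluidPDE.MovingFrameFTCRough
import Literature.Analysis.FluidPDE.DriftHeatLocalClass
import Literature.Analysis.FluidPDE.SpaceTimeRescaling
import HarnessLib

/-!
# Galilean frame and parabolic rescaling for the drift–heat class with a parasitic drift

Analysis/FluidPDE **proofs file** (theorems only: no definitions, no named facts, no `sorry`),
infrastructure for the swirl half (ii) of the named fact
`Literature.Analysis.FluidPDE.leiRenZhang2019_sliding` (Lei–Ren–Zhang, arXiv:1902.11229,
Lemma 5.1; in its proof: "one can convert the above equation into the standard heat equation by
a change of variable").

The swirl `Γ` of the regular representative `U + β(t) e_z` of a bounded ancient axisymmetric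
solution (KNSS 2009, §4) solves, off the axis and integrated in time,
`Γ(σ₂, w) − Γ(σ₁, w) = ∫ (ΔΓ − DΓ[b] − β(ρ) DΓ[e])(ρ, w) dρ` with a jointly continuous drift `b`
(`= U + (2/r)e_r`) and the rough parasitic part `β(ρ) e`, `e = e_z`. This file passes to the
**Galilean frame** `w = z(σ) + λ y` moving with the velocity `z' = c₁(σ) + β(σ) e`
(`c₁(σ) = U(σ, x₀)`), in which the parasitic part cancels exactly and the drift becomes
`b − c₁(σ)` — small far from the axis by Lemma 5.1 (i) —, combined with the **parabolic
rescaling** `σ = λ²τ + σ₀`, which multiplies the drift by `λ`: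

* `isDriftHeatSolutionOn_galilean_rescale` — under the displayed hypotheses on
  `[σ₀, σ₀ + λ²T] × B(x₀, R)`, the function `(τ, y) ↦ Γ(λ²τ + σ₀, z(λ²τ + σ₀) + λ y)` belongs to
  the tree's local drift–heat class `IsDriftHeatSolutionOn` (`DriftHeatLocalClass`; the class of
  KNSS 2009, Lemma 2.1 and of the interior Harnack inequality `Lieberman1996_harnack_drift_gap`)
  on `(0, T] × B(0, ϱ₀)` with drift `λ (b − c₁)(λ²τ + σ₀, z + λy)` and drift bound `A`, provided
  `‖b(σ, z(σ) + λy) − c₁(σ)‖ ≤ A/λ` there. The time-integrated equation in the frame is the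
  moving-frame FTC with rough multiplier `sub_eq_integral_of_path_add_smul`
  (`MovingFrameFTCRough`), followed by the substitution `σ = λ²τ + σ₀`; the slice derivatives are
  `D(Γ∘frame) = λ DΓ`, `Δ(Γ∘frame) = λ² ΔΓ` (`fderiv_comp_smul`, `laplacian_stPull`).

## Mathlib / tree search

Tree: `IsDriftHeatSolutionOn` (`DriftHeatLocalClass`), `sub_eq_integral_of_path_add_smul`
(`MovingFrameFTCRough`), `laplacian_stPull`, `stPull_apply` (`SpaceTimeRescaling`),
`intervalIntegrable_of_norm_le` (`KNSSRegularityGalilean`). Mathlib: `fderiv_comp_smul`,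
`fderiv_comp_add_left`, `intervalIntegral.smul_integral_comp_mul_add`,
`intervalIntegral.integral_congr`.

## References

* Z. Lei, X. Ren, Q. S. Zhang, *On ancient periodic solutions to axially-symmetric Navier–Stokes
  equations*, arXiv:1902.11229, proof of Lemma 5.1 (arXiv p. 13). [LeiRenZhang2019]
* G. Koch, N. Nadirashvili, G. Seregin, V. Šverák, Acta Math. 203 (2009) = arXiv:0709.3599, §1
  p. 3 (Galilean frame), §5 (5.11)–(5.13) p. 10 (parabolic rescaling of the swirl equation),
  Lemma 2.1 p. 5 (the class). [KochNadirashviliSereginSverak2009]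
-/

noncomputable section

open MeasureTheory Set Function Filter TopologicalSpace InnerProductSpace Metric
open _root_.Topology
open scoped RealInnerProductSpace Laplacian ContDiff NNReal Interval

namespace Literature.Analysis.FluidPDE

section GalileanRescale

variable {E : Type*} [NormedAddCommGroup E] [InnerProductSpace ℝ E] [FiniteDimensional ℝ E]
  [MeasurableSpace E] [BorelSpace E]

omit [FiniteDimensional ℝ E] [MeasurableSpace E] [BorelSpace E] in
/-- Slice derivative in the rescaled Galilean frame: `D(y ↦ Γ(z' + λy))(y) = λ DΓ(z' + λy)`
(no differentiability needed). [folklore] -/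
private theorem fderiv_frame_slice_aux (f : E → ℝ) (z' : E) (lam : ℝ) (y : E) :
    fderiv ℝ (fun y : E => f (z' + lam • y)) y = lam • fderiv ℝ f (z' + lam • y) := by
  have h := fderiv_comp_smul (𝕜 := ℝ) (f := fun x => f (z' + x)) (x := y) lam
  rw [fderiv_comp_add_left] at h
  exact h

omit [MeasurableSpace E] [BorelSpace E] in
/-- Slice Laplacian in the rescaled Galilean frame: `Δ(y ↦ Γ(z' + λy))(y) = λ² ΔΓ(z' + λy)` for
a `C²` slice (`laplacian_stPull`). [folklore] -/
private theorem laplacian_frame_slice_aux {f : E → ℝ} (hf : ContDiff ℝ 2 f) (z' : E) (lam : ℝ)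
    (y : E) : (Δ fun y : E => f (z' + lam • y)) y = lam ^ 2 * (Δ f) (z' + lam • y) := by
  have e : (fun y : E => f (z' + lam • y)) = stPull 0 lam 0 z' (fun _ : ℝ => f) 0 := by
    funext y; simp [stPull_apply]
  rw [e, laplacian_stPull 0 lam 0 z' (fun _ : ℝ => f) 0 y (by simpa using hf), smul_eq_mul]

/-- **The swirl-type drift–heat solution in a rescaled Galilean frame belongs to the local
drift–heat class.** Let `Γ` have `C²` slices with `∇Γ`, `ΔΓ` jointly continuous on
`[σ₀, σ₀ + λ²T] × E`, and satisfy on the ball `B(x₀, R)` the time-integrated equation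
`Γ(σ₂, w) − Γ(σ₁, w) = ∫ (ΔΓ(ρ)(w) − DΓ(ρ)(w)[b(ρ, w)] − β(ρ) DΓ(ρ)(w)[e]) dρ` with a jointly
measurable drift `b`, jointly continuous on `[σ₀, σ₀ + λ²T] × B(x₀, R)`, and `β` bounded
measurable. Let `z(σ) = z(σ₀) + ∫ (c₁ + β e)` be a frame with `c₁` bounded measurable, `z`
continuous, such that the points `z(σ) + λy`, `‖y‖ < ϱ₀`, stay in `B̄(x₀, R − 1)`, and suppose
the frame drift is small: `‖b(σ, z(σ) + λy) − c₁(σ)‖ ≤ A/λ`. Then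
`(τ, y) ↦ Γ(λ²τ + σ₀, z(λ²τ + σ₀) + λy)` is a member of `IsDriftHeatSolutionOn` on
`(0, T] × B(0, ϱ₀)` with drift `λ (b − c₁)` (composed with the frame) and drift bound `A`: in
the frame the parasitic part `β e` of the velocity cancels against `β DΓ[e]`
(`sub_eq_integral_of_path_add_smul`), and the rescaling multiplies `DΓ[·]` by `λ`, `ΔΓ` and
`dσ` by `λ²`. [cite: LeiRenZhang2019, proof of Lemma 5.1 (arXiv p. 13); KochNadirashviliSereginSverak2009, §1 p. 3 and (5.11)–(5.13) p. 10] -/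
theorem isDriftHeatSolutionOn_galilean_rescale
    {Γ : ℝ → E → ℝ} {b : ℝ → E → E} {c₁ : ℝ → E} {β : ℝ → ℝ} {e : E} {z : ℝ → E} {x₀ : E}
    {R σ₀ lam T ϱ₀ A N Cβ : ℝ} (hlam : 0 < lam)
    (hΓ2 : ∀ σ ∈ Icc σ₀ (σ₀ + lam ^ 2 * T), ContDiff ℝ 2 (Γ σ))
    (hDΓ : ContinuousOn (fun p : ℝ × E => fderiv ℝ (Γ p.1) p.2)
      (Icc σ₀ (σ₀ + lam ^ 2 * T) ×ˢ univ))
    (hΔΓ : ContinuousOn (fun p : ℝ × E => (Δ (Γ p.1)) p.2) (Icc σ₀ (σ₀ + lam ^ 2 * T) ×ˢ univ))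
    (hbm : Measurable (uncurry b))
    (hbc : ContinuousOn (uncurry b) (Icc σ₀ (σ₀ + lam ^ 2 * T) ×ˢ ball x₀ R))
    (hc₁m : Measurable c₁) (hc₁N : ∀ σ, ‖c₁ σ‖ ≤ N)
    (hβm : Measurable β) (hβC : ∀ σ, |β σ| ≤ Cβ)
    (heq : ∀ w ∈ ball x₀ R, ∀ σ₁ ∈ Icc σ₀ (σ₀ + lam ^ 2 * T), ∀ σ₂ ∈ Icc σ₀ (σ₀ + lam ^ 2 * T),
      σ₁ ≤ σ₂ → Γ σ₂ w - Γ σ₁ w =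
        ∫ ρ in σ₁..σ₂, ((Δ (Γ ρ)) w - fderiv ℝ (Γ ρ) w (b ρ w) - β ρ * fderiv ℝ (Γ ρ) w e))
    (hzc : Continuous z)
    (hz : ∀ σ ∈ Icc σ₀ (σ₀ + lam ^ 2 * T), z σ = z σ₀ + ∫ ρ in σ₀..σ, (c₁ ρ + β ρ • e))
    (hzin : ∀ σ ∈ Icc σ₀ (σ₀ + lam ^ 2 * T), ∀ y ∈ ball (0 : E) ϱ₀,
      z σ + lam • y ∈ closedBall x₀ (R - 1))
    (hsmall : ∀ σ ∈ Icc σ₀ (σ₀ + lam ^ 2 * T), ∀ y ∈ ball (0 : E) ϱ₀,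
      ‖b σ (z σ + lam • y) - c₁ σ‖ ≤ A / lam) :
    IsDriftHeatSolutionOn
      (fun τ y => lam • (b (lam ^ 2 * τ + σ₀) (z (lam ^ 2 * τ + σ₀) + lam • y) -
        c₁ (lam ^ 2 * τ + σ₀)))
      (fun τ y => Γ (lam ^ 2 * τ + σ₀) (z (lam ^ 2 * τ + σ₀) + lam • y)) A (Ioc 0 T)
      (ball 0 ϱ₀) := by
  have hl2 : 0 < lam ^ 2 := by positivity
  -- names for the frame solution and the frame drift
  set v : ℝ → E → ℝ := fun τ y => Γ (lam ^ 2 * τ + σ₀) (z (lam ^ 2 * τ + σ₀) + lam • y) with hv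
  set av : ℝ → E → E := fun τ y => lam • (b (lam ^ 2 * τ + σ₀) (z (lam ^ 2 * τ + σ₀) + lam • y) -
    c₁ (lam ^ 2 * τ + σ₀)) with hav
  -- the time map `τ ↦ λ²τ + σ₀` sends `(0, T]` into `[σ₀, σ₀ + λ²T]`
  set I : Set ℝ := Icc σ₀ (σ₀ + lam ^ 2 * T) with hI
  have hστ : ∀ τ ∈ Ioc (0 : ℝ) T, lam ^ 2 * τ + σ₀ ∈ I := fun τ hτ =>
    ⟨by nlinarith [hτ.1], by nlinarith [hτ.2]⟩
  -- the frame map `(τ, y) ↦ (λ²τ + σ₀, z(λ²τ + σ₀) + λy)` is continuous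
  have hframe : Continuous fun p : ℝ × E =>
      (lam ^ 2 * p.1 + σ₀, z (lam ^ 2 * p.1 + σ₀) + lam • p.2) := by
    fun_prop
  have hmaps : MapsTo (fun p : ℝ × E => (lam ^ 2 * p.1 + σ₀, z (lam ^ 2 * p.1 + σ₀) + lam • p.2))
      (Ioc 0 T ×ˢ ball (0 : E) ϱ₀) (I ×ˢ univ) := fun p hp =>
    mk_mem_prod (hστ p.1 hp.1) (mem_univ _)
  -- slice formulas
  have hDv : ∀ τ y, fderiv ℝ (v τ) y =
      lam • fderiv ℝ (Γ (lam ^ 2 * τ + σ₀)) (z (lam ^ 2 * τ + σ₀) + lam • y) := fun τ y =>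
    fderiv_frame_slice_aux (Γ (lam ^ 2 * τ + σ₀)) _ lam y
  have hΔv : ∀ τ ∈ Ioc (0 : ℝ) T, ∀ y, (Δ (v τ)) y =
      lam ^ 2 * (Δ (Γ (lam ^ 2 * τ + σ₀))) (z (lam ^ 2 * τ + σ₀) + lam • y) := fun τ hτ y =>
    laplacian_frame_slice_aux (hΓ2 _ (hστ τ hτ)) _ lam y
  -- (1) measurability of the frame drift
  have f1 : Measurable (uncurry av) := by
    have h1 : Measurable fun p : ℝ × E =>
        b (lam ^ 2 * p.1 + σ₀) (z (lam ^ 2 * p.1 + σ₀) + lam • p.2) :=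
      hbm.comp hframe.measurable
    have h2 : Measurable fun p : ℝ × E => c₁ (lam ^ 2 * p.1 + σ₀) :=
      hc₁m.comp (by fun_prop)
    exact (h1.sub h2).const_smul lam
  -- (2) the drift bound `λ · (A/λ) = A`
  have f2 : ∀ τ ∈ Ioc (0 : ℝ) T, ∀ y ∈ ball (0 : E) ϱ₀, ‖av τ y‖ ≤ A := by
    intro τ hτ y hy
    simp only [hav]
    rw [norm_smul, Real.norm_eq_abs, abs_of_pos hlam]
    calc lam * ‖b (lam ^ 2 * τ + σ₀) (z (lam ^ 2 * τ + σ₀) + lam • y) - c₁ (lam ^ 2 * τ + σ₀)‖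
        ≤ lam * (A / lam) := mul_le_mul_of_nonneg_left (hsmall _ (hστ τ hτ) y hy) hlam.le
      _ = A := by field_simp
  -- (3) `C²` slices
  have f3 : ∀ τ ∈ Ioc (0 : ℝ) T, ContDiffOn ℝ 2 (v τ) (ball (0 : E) ϱ₀) := fun τ hτ =>
    ((hΓ2 _ (hστ τ hτ)).comp (contDiff_const.add (contDiff_const.smul contDiff_id))).contDiffOn
  -- (4) joint continuity of the slice derivative
  have f4 : ContinuousOn (fun p : ℝ × E => fderiv ℝ (v p.1) p.2) (Ioc 0 T ×ˢ ball (0 : E) ϱ₀) := by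
    have h : ContinuousOn (fun p : ℝ × E =>
        lam • fderiv ℝ (Γ (lam ^ 2 * p.1 + σ₀)) (z (lam ^ 2 * p.1 + σ₀) + lam • p.2))
        (Ioc 0 T ×ˢ ball (0 : E) ϱ₀) :=
      (hDΓ.comp hframe.continuousOn hmaps).const_smul lam
    exact h.congr fun p _ => hDv p.1 p.2
  -- (5) joint continuity of the slice Laplacian
  have f5 : ContinuousOn (fun p : ℝ × E => (Δ (v p.1)) p.2) (Ioc 0 T ×ˢ ball (0 : E) ϱ₀) := by
    have h0 : ContinuousOn ((fun p : ℝ × E => (Δ (Γ p.1)) p.2) ∘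
        (fun p : ℝ × E => (lam ^ 2 * p.1 + σ₀, z (lam ^ 2 * p.1 + σ₀) + lam • p.2)))
        (Ioc 0 T ×ˢ ball (0 : E) ϱ₀) := hΔΓ.comp hframe.continuousOn hmaps
    have h := h0.const_smul (lam ^ 2)
    refine h.congr fun p hp => ?_
    rw [hΔv p.1 hp.1 p.2]
    simp only [Pi.smul_apply, Function.comp_apply, smul_eq_mul]
  -- (6) the time-integrated equation in the frame
  have f6 : ∀ y ∈ ball (0 : E) ϱ₀, ∀ τ₁ ∈ Ioc (0 : ℝ) T, ∀ τ₂ ∈ Ioc (0 : ℝ) T, τ₁ ≤ τ₂ →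
      v τ₂ y - v τ₁ y = ∫ r in τ₁..τ₂, ((Δ (v r)) y - fderiv ℝ (v r) y (av r y)) := by
    intro y hy τ₁ hτ₁ τ₂ hτ₂ h12
    have hσ12 : lam ^ 2 * τ₁ + σ₀ ≤ lam ^ 2 * τ₂ + σ₀ := by nlinarith
    have hσ₁I : lam ^ 2 * τ₁ + σ₀ ∈ I := hστ τ₁ hτ₁
    have hσ₂I : lam ^ 2 * τ₂ + σ₀ ∈ I := hστ τ₂ hτ₂
    have hsubI : Icc (lam ^ 2 * τ₁ + σ₀) (lam ^ 2 * τ₂ + σ₀) ⊆ I := fun ρ hρ =>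
      ⟨hσ₁I.1.trans hρ.1, hρ.2.trans hσ₂I.2⟩
    -- Step 1: the moving-frame FTC along `ρ ↦ z ρ + λy`
    have hN0 : 0 ≤ N := (norm_nonneg _).trans (hc₁N 0)
    have hCβ0 : 0 ≤ Cβ := (abs_nonneg _).trans (hβC 0)
    have hvel : ∀ ρ, ‖c₁ ρ + β ρ • e‖ ≤ N + Cβ * ‖e‖ := fun ρ => by
      refine (norm_add_le _ _).trans (add_le_add (hc₁N ρ) ?_)
      rw [norm_smul, Real.norm_eq_abs]
      exact mul_le_mul_of_nonneg_right (hβC ρ) (norm_nonneg _)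
    have hvm : AEStronglyMeasurable (fun ρ => c₁ ρ + β ρ • e) volume :=
      (hc₁m.add (hβm.smul_const e)).aestronglyMeasurable
    have hvi : ∀ a' b' : ℝ, IntervalIntegrable (fun ρ => c₁ ρ + β ρ • e) volume a' b' :=
      intervalIntegrable_of_norm_le hvm hvel
    have hpath : ∀ ρ ∈ Icc (lam ^ 2 * τ₁ + σ₀) (lam ^ 2 * τ₂ + σ₀),
        z ρ + lam • y = (z (lam ^ 2 * τ₁ + σ₀) + lam • y) +
          ∫ r in (lam ^ 2 * τ₁ + σ₀)..ρ, (c₁ r + β r • e) := by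
      intro ρ hρ
      rw [hz ρ (hsubI hρ), hz _ hσ₁I,
        ← intervalIntegral.integral_add_adjacent_intervals (hvi σ₀ (lam ^ 2 * τ₁ + σ₀))
          (hvi (lam ^ 2 * τ₁ + σ₀) ρ)]
      abel
    have hR1 : R - 1 < R := by linarith
    have hFTC := sub_eq_integral_of_path_add_smul (E := E) (F := ℝ)
      (Φ := Γ) (φ₁ := fun ρ w => (Δ (Γ ρ)) w - fderiv ℝ (Γ ρ) w (b ρ w))
      (φ₂ := fun ρ w => -fderiv ℝ (Γ ρ) w e) (β := β)
      (z := fun ρ => z ρ + lam • y) (z' := fun ρ => c₁ ρ + β ρ • e)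
      (s := lam ^ 2 * τ₁ + σ₀) (t := lam ^ 2 * τ₂ + σ₀) (c := x₀) (R₀ := R) (R₁ := R - 1)
      hσ12 hR1 ?_ ?_ ?_ hβm hβC ?_ ?_ hvm hvel hpath (fun ρ hρ => hzin ρ (hsubI hρ) y hy)
    rotate_left
    · -- the integrated equation in the form `Φ σ w = Φ s w + ∫ (φ₁ + β • φ₂)`
      intro ρ hρ w hw
      have h := heq w hw _ hσ₁I ρ (hsubI hρ) hρ.1
      rw [← sub_eq_iff_eq_add', h]
      refine intervalIntegral.integral_congr fun r _ => ?_
      simp only [smul_eq_mul]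
      ring
    · -- joint continuity of `φ₁ = ΔΓ − DΓ[b]`
      have hsub' : Icc (lam ^ 2 * τ₁ + σ₀) (lam ^ 2 * τ₂ + σ₀) ×ˢ ball x₀ R ⊆ I ×ˢ ball x₀ R :=
        prod_mono hsubI Subset.rfl
      have h1 : ContinuousOn (fun p : ℝ × E => (Δ (Γ p.1)) p.2)
          (Icc (lam ^ 2 * τ₁ + σ₀) (lam ^ 2 * τ₂ + σ₀) ×ˢ ball x₀ R) :=
        hΔΓ.mono (prod_mono hsubI (subset_univ _))
      have h2 : ContinuousOn (fun p : ℝ × E => fderiv ℝ (Γ p.1) p.2 (b p.1 p.2))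
          (Icc (lam ^ 2 * τ₁ + σ₀) (lam ^ 2 * τ₂ + σ₀) ×ˢ ball x₀ R) :=
        (hDΓ.mono (prod_mono hsubI (subset_univ _))).clm_apply (hbc.mono hsub')
      exact h1.sub h2
    · -- joint continuity of `φ₂ = −DΓ[e]`
      exact ((hDΓ.mono (prod_mono hsubI (subset_univ _))).clm_apply continuousOn_const).neg
    · -- differentiability of the slices
      intro ρ hρ w _
      exact ((hΓ2 ρ (hsubI hρ)).differentiable (by norm_num)) w
    · exact hDΓ.mono (prod_mono hsubI (subset_univ _))
    -- Step 2: the parasitic part cancels; substitute `ρ = λ²r + σ₀`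
    have hG : ∀ ρ, ((Δ (Γ ρ)) (z ρ + lam • y) -
        fderiv ℝ (Γ ρ) (z ρ + lam • y) (b ρ (z ρ + lam • y))) +
        β ρ • (-fderiv ℝ (Γ ρ) (z ρ + lam • y) e) +
        fderiv ℝ (Γ ρ) (z ρ + lam • y) (c₁ ρ + β ρ • e) =
        (Δ (Γ ρ)) (z ρ + lam • y) -
          fderiv ℝ (Γ ρ) (z ρ + lam • y) (b ρ (z ρ + lam • y) - c₁ ρ) := by
      intro ρ
      rw [map_add, map_smul, map_sub, smul_eq_mul, smul_eq_mul]
      ring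
    simp only [hG] at hFTC
    have hlhs : v τ₂ y - v τ₁ y =
        Γ (lam ^ 2 * τ₂ + σ₀) (z (lam ^ 2 * τ₂ + σ₀) + lam • y) -
          Γ (lam ^ 2 * τ₁ + σ₀) (z (lam ^ 2 * τ₁ + σ₀) + lam • y) := rfl
    rw [hlhs, hFTC]
    have hsubst := intervalIntegral.smul_integral_comp_mul_add
      (f := fun ρ => (Δ (Γ ρ)) (z ρ + lam • y) -
        fderiv ℝ (Γ ρ) (z ρ + lam • y) (b ρ (z ρ + lam • y) - c₁ ρ))
      (a := τ₁) (b := τ₂) (lam ^ 2) σ₀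
    rw [← hsubst, smul_eq_mul, ← intervalIntegral.integral_const_mul]
    refine intervalIntegral.integral_congr fun r hr => ?_
    have hrI : r ∈ Ioc (0 : ℝ) T := by
      rw [uIcc_of_le h12] at hr
      exact ⟨hτ₁.1.trans_le hr.1, hr.2.trans hτ₂.2⟩
    simp only [hav]
    rw [hDv r y, hΔv r hrI y]
    simp only [FunLike.coe_smul, Pi.smul_apply, smul_eq_mul, map_smul]
    ring
  exact ⟨f1, f2, f3, f4, f5, f6⟩

end GalileanRescale

end Literature.Analysis.FluidPDE

end
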